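import Summits.BirchSwinnertonDyer.BirchSwinnertonDyer.Theorems.KolyvaginRoadThreeMethod2Defs
import Literature.NumberTheory.EllipticCurves.GrossPointsPicardAction
import Literature.NumberTheory.EllipticCurves.HeegnerPointsOfConductor
import HarnessLib

/-!
# Route `KolyvaginRoadThree`, crux `ZhangSharpFrameAtThreeHL` (item stmt-BirchSwinnertonDyer-19574), stub S1:
# the DEFINITE FIRST FLOOR of W. Zhang's Thm 7.2 at `p = 3` — vocabulary (definitions only)
# (cell `bsd-stepL`, OWNER seat `bsd-stepL-koly` g16; design note `HOME/koly/S1-FIRST-FLOOR-DESIGN-g16.md`)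

Stub S1 `stub_bottomRankOneAtThree` of the registered METHOD line (at an HL A1 frame with `dim_𝔽₃ Sel₃(E/K) = 1` the conductor-1
Kolyvagin class `c(1) = δ(y_K)` is non-zero mod 3) is W. Zhang's Thm 7.2 (Camb. J. Math. 2 (2014), p. 232) for `(N⁺, N⁻) = (N, 1)` run
at `p = 3 ∥ N`. Its printed proof (pp. 232–233) uses NO Shimura curve: one unipotent-admissible prime `q` killing the Selmer line (stub A,
LANDED), the DEFINITE Shimura set `X_{N,q}` of the quaternion algebra ramified at `{q, ∞}` with `Γ₀(N)`-structure (§3.1), a mod-`p`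
Hecke eigenform `φ` on it (level raising Thm 2.1 + multiplicity one (4.8)), the Jochnowitz congruence `loc_q c(1) = φ(Red_q x_K)` ((4.9),
Thm 6.5: Ihara + the reduction of CM points Thm 3.1), Gross's special value formula (Cor 6.2, Thm 6.4) and the rank-0 `p`-part of BSD for
the raised form (Thm 7.1: Skinner–Urban + Kato). The DEFINITE objects all exist in the tree's Brandt-module library: a setup
`S : Brandt.XiSetup N q` (`Literature/NumberTheory/Automorphic/BrandtXi.lean`: definite quaternion algebra of discriminant `q` with an
Eichler order of level `N`), its class set `Brandt.ClassSet S.O` and Brandt matrices `Brandt.matrix S.O ℓ` (Hecke operators `T(ℓ)` on the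
Brandt module `ℤ[Cls O]`, Voight 41.1.1), the Gross points `grossPoints K S 1 ⊆ GrossSpace S.D K` of conductor 1 (BD96 §2.1, optimal
embeddings of `𝓞_K`; `GrossPoints.lean`), the action of `Pic(𝓞_K)` (`GrossSpace.picardMulAction`, BD96 §2.3 (4)) and the pairing
`GrossSpace.yValue S φ x = w_[x] φ_[x]` (BD96 §1.9 `⟨P, v_f⟩`). This file NAMES, over that vocabulary, the three statements into which
S1 decomposes (the companion proof file `KolyvaginRoadThreeMethod2BottomOfDefiniteFirstFloor.lean` proves S1's conclusion at a frame
from them and stub A):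

* `IsModThreeEigenline W S φ` — `φ : Cls O → ℤ` spans THE mod-3 eigenline of `E` in the Brandt module: `φ ≢ 0 (mod 3)`,
  `T(ℓ) φ ≡ a_ℓ(E) φ (mod 3)` for all primes `ℓ ∤ 3 N⁺ N⁻` (divisor model, `mulVec`), and every such `ψ` is `≡ a·φ (mod 3)` (multiplicity
  one). [Z14 Thm 2.1 + Lemma 3.3 ∕ (4.8) read on the definite set; BD05 Thm 5.15.]
* `grossPeriod K S φ x₀ = Σ_{σ ∈ Pic(𝓞_K)} ⟨σ • x₀, φ⟩ ∈ ℤ` — Gross's period of `φ` along the conductor-1 CM orbit (Gross 1987 §3,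
  (6.1)–(6.2) of [Z14]; `finsum`, the class group is finite).
* `DefiniteLevelRaisingAt W K q` — (DLR): there are a setup `S : XiSetup N q`, a conductor-1 Gross point `x₀` and a mod-3 eigenline `φ`.
* `JochnowitzAtThree W K Dt β ι q` — (J′): for every such `(S, x₀, φ)` and every conductor-1 Kolyvagin–Heegner datum `d`, the class
  `c(1)` is locally trivial at the place above `q` iff `3 ∣ grossPeriod` [Z14 Thm 3.1 + (4.9) = BD05 Thm 9.2 (Ihara), Thm 6.5; the vanishing is
  independent of `x₀` since `Pic(𝓞_K) × (Atkin–Lehner)` acts transitively on conductor-1 Gross points and `φ̄` is an Atkin–Lehner eigenvector].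
* `DefiniteUnitValueAtThree W K c q` — (V′): for every such `(S, x₀, φ)`, if the canonical level-`{q}` Selmer spaces `SelQ {q} ±` vanish then
  `3 ∤ grossPeriod` [Z14 (7.2)–(7.3) (Thm 7.1 for `g_q` over `K`, multiplicative at 3) + Cor 6.2 + Thm 6.4 + Thm 5.2 ∕ Prop 5.4 — the deep
  input; at `p = 3` = the koly memo chain R-SU3 + B♭ + η-bookkeeping, CARD §R row R7].

HONEST FRAMING ∕ DOMAIN. (1) Nothing here is asserted: five `def`s with bodies, 0 theorems about them, 0 `sorry`, no instance, no notation;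
closes nothing (T7). (2) WEIGHTS: `q ≡ 1 (mod 3)` splits in `ℚ(√−3)`, so the definite algebra ramified at `q` contains no `ℚ(ζ₃)`, no order of
it has a unit of order 3, every `Brandt.weight` is a 3-adic unit, and the divisor model (`mulVec`) and Zhang's function model of `φ`
correspond by `φ ↦ wφ` with `yValue` evaluating the function model — so «`3 ∣ grossPeriod`» IS Zhang's «`φ(x_{q,K}) = 0` in `k₀`».
(3) THE PIN: `IsModThreeEigenline` uses the ANEMIC Hecke algebra (`T(ℓ)`, `ℓ ∤ 3 N q`; the tree identifies `Brandt.matrix S.O q` with the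
Atkin–Lehner involution `W_q` (`BrandtMatrixRamified.lean`) but types no `U_ℓ` at `ℓ ∣ N`). Zhang pins `φ` by the FULL algebra (§3.9, with
`U_ℓ`, `ℓ ∣ N q`). The two agree iff `S₂(Γ₀(Nq))^{q-new}` carries no mod-3-CONGRUENT OLDFORM, i.e. iff `ρ̄_{E,3}` has Serre conductor exactly
`N` (ramified at every `ℓ ∥ N` including 3, no conductor drop at additive `ℓ`); at frames where it does not (non-split `ℓ ∥ N` with
`3 ∣ v_ℓ(Δ)`, the finite-at-3 branch, additive drops) the anemic mod-3 eigenspace is ≥ 2-dimensional, `IsModThreeEigenline` is uninhabited,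
(DLR) FAILS and (J′)∕(V′) are vacuous — there the statements must be refined with `U`-operators (a definition-lane item; cf. koly
MEMO-v3.1 Lemma P, C2-GAP2 Lemma T). The companion glue is stated FRAME-BY-FRAME for this reason. (4) At `p ≥ 5` with BD-admissible `q`,
(DLR)∕(J′)∕(V′) on the conductor-`N` locus are in print ([Z14] Thms 2.1, 3.1, 6.5, 7.2 with (4.8)–(4.9); BD05 Thms 5.15, 9.2); at `p = 3`
with unipotent-admissible `q` they are the cell's memo theorems (MEMO-v2 U1–U8, §4.5–4.8; R-SU3; MEMO-v4), refereed there, not here.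
PARTITION: O2@3 (B10) × A1 × crux 19574 × stub S1 — types-the-object-of.

References: [cite: WZhang2014, §3.1, Thm. 2.1, Thm. 3.1, Lemma 3.3, (4.7)–(4.9), Cor. 6.2, Thm. 6.4, Thm. 6.5, Thm. 7.1, Thm. 7.2]
[cite: BertoliniDarmon1996, §1.9, §2.1, §2.3] [cite: BertoliniDarmon2005, Thm. 5.15, Thm. 9.2] [cite: Gross1987, §3, §11]
[cite: Voight2021, (41.1.1)].
-/

noncomputable section

open scoped Classical

namespace Summit.BirchSwinnertonDyer.Rank1Residual.X11b.Three.Koly.Method2DefiniteFirstFloor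

open WeierstrassCurve NumberField IsDedekindDomain
  Literature.NumberTheory.EllipticCurves Literature.NumberTheory.EllipticCurves.ModularForms
  Literature.NumberTheory.GaloisRepresentations Literature.NumberTheory.Automorphic Module

open Summit.BirchSwinnertonDyer.Rank1Residual.X11b.Three.Koly.Method2

variable (W : WeierstrassCurve ℚ) [W.IsGloballyMinimal] (K : Type) [Field K] [NumberField K]

/-- **The mod-3 Brandt EIGENLINE of `E` on the definite Shimura set of the setup `S`** (divisor model): `φ : Cls O → ℤ` with
`φ ≢ 0 (mod 3)`, `T(ℓ) φ ≡ a_ℓ(E) φ (mod 3)` for every prime `ℓ ∤ 3 N⁺ N⁻` (`Brandt.matrix … ℓ` acting by `mulVec`; `a_ℓ(E)` the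
Frobenius trace of the globally minimal `W`), and MULTIPLICITY ONE: every `ψ` with the same congruences is `≡ a φ (mod 3)` for an
integer `a`. W. Zhang's `φ : X_{mq} → k₀` of (4.7) with (4.8) `dim_{k₀} ℤ[X_{mq}] ⊗_𝕋 𝕋/ker χ = 1`, in the anemic form the tree can state
(module docstring, THE PIN). [cite: WZhang2014, (4.7)–(4.8)] [cite: BertoliniDarmon2005, Thm. 5.15] -/
def IsModThreeEigenline {Nplus Nminus : ℕ} (S : Brandt.XiSetup Nplus Nminus) [Fintype (Brandt.ClassSet S.O)]
    (φ : Brandt.ClassSet S.O → ℤ) : Prop :=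
  (∃ i, ¬ (3 : ℤ) ∣ φ i) ∧
  (∀ ℓ : ℕ, ℓ.Prime → ¬ ℓ ∣ 3 * Nplus * Nminus →
    ∀ i, (3 : ℤ) ∣ (Brandt.matrix S.O ℓ).mulVec φ i - W.frobeniusTrace ℓ * φ i) ∧
  (∀ ψ : Brandt.ClassSet S.O → ℤ,
    (∀ ℓ : ℕ, ℓ.Prime → ¬ ℓ ∣ 3 * Nplus * Nminus →
      ∀ i, (3 : ℤ) ∣ (Brandt.matrix S.O ℓ).mulVec ψ i - W.frobeniusTrace ℓ * ψ i) →
    ∃ a : ℤ, ∀ i, (3 : ℤ) ∣ ψ i - a * φ i)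

/-- **Gross's period of `φ` along the conductor-1 CM orbit of `x₀`**: `Σ_{σ ∈ Pic(𝓞_K)} ⟨σ • x₀, φ⟩ ∈ ℤ` (Gross 1987 §3 ∕ §11: the
special value `L(g/K, 1)` is, up to the period and `⟨φ, φ⟩`, the square of this sum; [Z14] (6.1)–(6.2), Cor. 6.2; BD96 §2.5 `y_0`).
`Pic(𝓞_K) = ClassGroup (quadOrder K 1)` acts through `GrossSpace.picardMulAction 1`; `finsum` (the class group is finite).
[cite: WZhang2014, (6.1)–(6.2), Cor. 6.2] [cite: BertoliniDarmon1996, §2.5] -/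
def grossPeriod {Nplus Nminus : ℕ} (S : Brandt.XiSetup Nplus Nminus) (φ : Brandt.ClassSet S.O → ℤ)
    (x₀ : GrossSpace S.D K) : ℤ :=
  ∑ᶠ σ : ClassGroup (quadOrder K 1), GrossSpace.yValue S φ (σ • x₀)

variable [NeZero (W.conductorNorm ℤ)]

/-- **(DLR) DEFINITE LEVEL RAISING at the unipotent-admissible prime `q`** (the definite half of [Z14] Thm 2.1 + Lemma 3.3 at `p = 3`):
there exist a Brandt setup of level `(N, q)` (definite algebra ramified at `{q, ∞}`, Eichler order of level `N` — Hilbert reciprocity), a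
Gross point of conductor 1 on it (BD96 Lemma 2.1: every `ℓ ∣ N` splits in `K`, `q` is inert) and a mod-3 eigenline of `E`
(`IsModThreeEigenline`). Expected TRUE at good `q` on the frames where `ρ̄_{E,3}` has conductor exactly `N` (module docstring, THE PIN);
numerically: koly g15 census, a congruent `q`-new form at 58∕58 levels. [cite: WZhang2014, Thm. 2.1, Lemma 3.3]
[cite: BertoliniDarmon1996, Lemma 2.1] -/
def DefiniteLevelRaisingAt (q : {q // IsUAdmissiblePrime W K q}) : Prop :=
  ∃ (S : Brandt.XiSetup (W.conductorNorm ℤ) (q : ℕ)) (_ : Fintype (Brandt.ClassSet S.O))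
    (x₀ : GrossSpace S.D K) (φ : Brandt.ClassSet S.O → ℤ),
    x₀ ∈ grossPoints K S 1 ∧ IsModThreeEigenline W S φ

variable [W.IsElliptic]

/-- **(J′) JOCHNOWITZ CONGRUENCE at 3 for the conductor-1 class** ([Z14] Thm 3.1 + (4.9) = BD05 Thm 9.2, and Thm 6.5): for every Brandt
setup of level `(N, q)`, conductor-1 Gross point `x₀`, mod-3 eigenline `φ` and conductor-1 Kolyvagin–Heegner datum `d` of the frame, the
class `c(1) = d.kolyvaginClass 3 1 ∈ H¹(K, E[3])` is LOCALLY TRIVIAL at the place above `q` iff `3 ∣ grossPeriod K S φ x₀` (printed: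
`loc_q c(1) = φ(Red_q(x_K))` under `H¹_fin(K_q, V) ≅ k₀`; independence of `x₀`: transitivity of `Pic(𝓞_K) × W` on conductor-1 Gross
points and `φ̄` an Atkin–Lehner eigenvector by multiplicity one). At `p = 3`: brick R6 of the crux card (Ihara p-free per [SZ] L.5.2 ∕
Cor 5.3; multiplicity one at `3 ∣ N⁺` per Tilouine ∕ Helm). [cite: WZhang2014, Thm. 3.1, (4.9), Thm. 6.5]
[cite: BertoliniDarmon2005, Thm. 9.2] -/
def JochnowitzAtThree (Dt : ModularParametrizationData W (W.conductorNorm ℤ)) (β : ℤ) (ι : K →+* ℂ)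
    (q : {q // IsUAdmissiblePrime W K q}) : Prop :=
  ∀ (S : Brandt.XiSetup (W.conductorNorm ℤ) (q : ℕ)) [Fintype (Brandt.ClassSet S.O)]
    (x₀ : GrossSpace S.D K) (φ : Brandt.ClassSet S.O → ℤ),
    x₀ ∈ grossPoints K S 1 → IsModThreeEigenline W S φ →
    ∀ (d : KolyvaginHeegnerData Dt β ι 1) (v : HeightOneSpectrum (𝓞 K)), ((q : ℕ) : 𝓞 K) ∈ v.asIdeal →
      (d.kolyvaginClass Nat.prime_three 1 ∈
          (W.baseChange K).torsionLocalKer (v.adicCompletion K) ((3 ^ 1 : ℕ) : ℤ) ↔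
        (3 : ℤ) ∣ grossPeriod K S φ x₀)

/-- **(V′) RANK-0 UNIT VALUE of the raised form, read through Gross's formula** ([Z14] (7.2)–(7.3) + Cor. 6.2 + Thm. 6.4 + Thm. 5.2 ∕
Prop. 5.4): for every Brandt setup of level `(N, q)`, conductor-1 Gross point `x₀` and mod-3 eigenline `φ`, if the canonical level-`{q}`
Selmer spaces of `E/K` vanish in both signs (`SelQ W K c {q} ± = ⊥`, = `Sel_𝔭(A_{g_q}/K) = 0` under Thm 5.2) then `3 ∤ grossPeriod`
(`L^{alg}(g_q/K, 1)` is a unit by Thm 7.1 — Skinner–Urban + Kato for `g_q` over `K`, multiplicative-ordinary at `3 ∥ N` — after the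
Tamagawa ∕ η cancellation, and equals `φ(x_{q,K})²` up to units by Gross's formula). The DEEP input of S1; at `p = 3` = brick R7 (R-SU3 + B♭ +
η-bookkeeping, memo-grade). [cite: WZhang2014, Thm. 7.1, (7.2)–(7.3), Cor. 6.2, Thm. 6.4, Thm. 5.2] -/
def DefiniteUnitValueAtThree (c : K ≃ₐ[ℚ] K) [Module (ZMod 3) (V3 W K)] (q : {q // IsUAdmissiblePrime W K q}) : Prop :=
  ∀ (S : Brandt.XiSetup (W.conductorNorm ℤ) (q : ℕ)) [Fintype (Brandt.ClassSet S.O)]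
    (x₀ : GrossSpace S.D K) (φ : Brandt.ClassSet S.O → ℤ),
    x₀ ∈ grossPoints K S 1 → IsModThreeEigenline W S φ →
    SelQ W K c {q} true = ⊥ → SelQ W K c {q} false = ⊥ → ¬ (3 : ℤ) ∣ grossPeriod K S φ x₀

end Summit.BirchSwinnertonDyer.Rank1Residual.X11b.Three.Koly.Method2DefiniteFirstFloor

end
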